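import Literature.Computability.Complexity.UmansFPDecode
import HarnessLib

/-!
# Umans' generator, machine level VIII: the decoder and the learning step run in polynomial time

Literature / circuit complexity — derandomization. Eighth machine-level file of the tree's proof of
C. Umans, JCSS 2003, Thm. 6; machine side of `UmansFPDecode.lean`. Sudan's system, the interpolant,
the agreement count, the candidates, the survivors, the decoding of one coordinate, and the learning
step on tables are computed on codes by polynomial-time string functions, assembled in the typed
algebra `CodeFP` from the bricks of the previous files (`kerVecKC`, `rrLevelsLC`, `kevalC`, …):

* `pairsLC`, `rowOfC`, `rowsLC`, `chunksLC`, `interpLC`, `agreeLC`, `candsLC`, `nodesOKC`,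
  `survLC`, `pickLC`, `decodeCoordLC`;
* **`learnLC`**, **`stepLC`** — with the predictor given by a `CodeFP` hypothesis on a program
  `gL : G → List (List ℕ) → List (List ℕ)` reading its own data of type `G`.

All numeric parameters but the agreement threshold `A` travel in unary. Everything is proved; no
named fact.

## References

* C. Umans, *Pseudo-random generators for all hardnesses*, JCSS 67 (2003), §6.2 [Umans2003].
* S. Arora, B. Barak, *Computational Complexity: A Modern Approach*, CUP 2009, §1.3 [AroraBarak2009].
-/

noncomputable section

namespace Literature.Computability.Complexity

open Polynomial Literature.InformationTheory.Coding
open Literature.InformationTheory.Coding.GF2X CodeFP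

namespace UmansFP

section Machine

/-- The code of coefficient lists / vectors. -/
local notation "L" => rawE natE

/-- The code of matrices, position tables, tables of `L`-lists. -/
local notation "matE" => rawE (rawE natE)

/-- **Unary product.** (The same certificate is proved as `QuantumComplexity.unMul_codeFP` in
`QuantumComplexity/HidingProgramMachine.lean`; it is re-proved here in two lines rather than
imported, to keep the Aaronson–Arkhipov machine files out of the import closure of the Umans
generator chain.) [folklore] -/
theorem unMulC : CodeFP (pairE unE unE) unE (fun p => p.1 * p.2) :=
  ((ulength unitE).comp (unitsMul.comp ((replicateUnit.comp (fst _ _)).pair (replicateUnit.comp (snd _ _))))).congr fun p => by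
    simp

/-- **The constraint pairs on codes**: `(1^q, Sl) ↦ pairsL q Sl`. [folklore] -/
theorem pairsLC : CodeFP (pairE unE matE) (rawE (pairE natE natE)) (fun t => pairsL t.1 t.2) := by
  have hin : CodeFP (pairE natE L) (rawE (pairE natE natE)) (fun t => t.2.map fun v => (t.1, v)) :=
    map (σ := ℕ) (eσ := natE) (eα := natE) (eβ := pairE natE natE) (g := fun t => (t.1, t.2)) ((fst _ _).pair (snd _ _))
  have hrow : CodeFP (pairE matE natE) (rawE (pairE natE natE)) (fun t => (t.1.getD t.2 []).map fun v => (t.2, v)) :=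
    hin.comp ((snd _ _).pair ((rawGetD L (d := ([] : List ℕ)) rfl).comp ((fst _ _).pair (snd _ _))))
  exact (((flatten (pairE natE natE)).comp ((map hrow).comp ((snd _ _).pair (urange.comp (fst _ _))))).congr fun t => by
    rw [pairsL, List.flatMap_def])

/-- **The row of a pair on codes**: `(c, 1^I, 1ⁿ, (b, v)) ↦ rowOf c I n (b, v)`. [folklore] -/
theorem rowOfC : CodeFP (pairE kctxE (pairE unE (pairE unE (pairE natE natE)))) L (fun t => rowOf t.1 t.2.1 t.2.2.1 t.2.2.2) := by
  -- item `u` (binary), context `(c, I, n, b, v)`; the exponents `u % I`, `u / I` are made unary against `n`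
  let σE : (ℕ × ℕ × ℕ) × ℕ × ℕ × ℕ × ℕ → List Bool := pairE kctxE (pairE unE (pairE unE (pairE natE natE)))
  have hc : CodeFP (pairE σE natE) kctxE (fun t => t.1.1) := (fst _ _).fst'
  have hI : CodeFP (pairE σE natE) natE (fun t => t.1.2.1) := natOfUn.comp (fst _ _).snd'.fst'
  have hn : CodeFP (pairE σE natE) unE (fun t => t.1.2.2.1) := (fst _ _).snd'.snd'.fst'
  have hb : CodeFP (pairE σE natE) natE (fun t => t.1.2.2.2.1) := (fst _ _).snd'.snd'.snd'.fst'
  have hv : CodeFP (pairE σE natE) natE (fun t => t.1.2.2.2.2) := (fst _ _).snd'.snd'.snd'.snd'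
  have hu : CodeFP (pairE σE natE) natE (fun t => t.2) := snd _ _
  have he1 : CodeFP (pairE σE natE) unE (fun t => min (t.2 % t.1.2.1) t.1.2.2.1) := unOfNatMin.comp (hn.pair (natMod.comp (hu.pair hI)))
  have he2 : CodeFP (pairE σE natE) unE (fun t => min (t.2 / t.1.2.1) t.1.2.2.1) := unOfNatMin.comp (hn.pair (natDiv.comp (hu.pair hI)))
  have hg : CodeFP (pairE σE natE) natE
      (fun t => cmul t.1.1 (cpow t.1.1 t.1.2.2.2.1 (min (t.2 % t.1.2.1) t.1.2.2.1)) (cpow t.1.1 t.1.2.2.2.2 (min (t.2 / t.1.2.1) t.1.2.2.1))) :=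
    (kmulFP.comp (hc.pair ((kpowFP.comp (hc.pair (hb.pair he1))).pair (kpowFP.comp (hc.pair (hv.pair he2))))) :)
  refine (((map hg).comp ((CodeFP.id _).pair (urange.comp (snd _ _).snd'.fst'))).congr fun t => ?_)
  obtain ⟨c, I, n, b, v⟩ := t
  show (List.range n).map _ = rowOf c I n (b, v)
  refine List.map_congr_left fun u hu => ?_
  have hu' := List.mem_range.1 hu
  dsimp only [id]
  rw [min_eq_left ((Nat.mod_le _ _).trans hu'.le), min_eq_left ((Nat.div_le_self _ _).trans hu'.le)]

/-- The code of `(c, 1^I, 1^J, 1^q, Sl)`. -/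
local notation "sysE" => pairE kctxE (pairE unE (pairE unE (pairE unE (rawE (rawE natE)))))

/-- **The rows on codes**: `(c, 1^I, 1^J, 1^q, Sl) ↦ rowsL c I J q Sl`. [folklore] -/
theorem rowsLC : CodeFP sysE matE (fun t => rowsL t.1 t.2.1 t.2.2.1 t.2.2.2.1 t.2.2.2.2) := by
  have hrow : CodeFP (pairE (pairE kctxE (pairE unE unE)) (pairE natE natE)) L (fun t => rowOf t.1.1 t.1.2.1 t.1.2.2 t.2) :=
    (rowOfC.comp ((fst _ _).fst'.pair ((fst _ _).snd'.fst'.pair ((fst _ _).snd'.snd'.pair (snd _ _)))) :)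
  have hn : CodeFP sysE unE (fun t => t.2.2.1 * t.2.1) := unMulC.comp ((snd _ _).snd'.fst'.pair (snd _ _).fst')
  exact (((map hrow).comp (((fst _ _).pair ((snd _ _).fst'.pair hn)).pair (pairsLC.comp ((snd _ _).snd'.snd'.fst'.pair
    (snd _ _).snd'.snd'.snd')))).congr fun _ => rfl)

/-- **The chunks on codes**: `(1^I, 1^J, w) ↦ chunksL I J w`. [folklore] -/
theorem chunksLC : CodeFP (pairE unE (pairE unE L)) matE (fun t => chunksL t.1 t.2.1 t.2.2) := by
  -- item `j` (binary, `< J`), context `(I, J, w)`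
  let σE : ℕ × ℕ × List ℕ → List Bool := pairE unE (pairE unE L)
  have hI : CodeFP (pairE σE natE) unE (fun t => t.1.1) := (fst _ _).fst'
  have hJ : CodeFP (pairE σE natE) unE (fun t => t.1.2.1) := (fst _ _).snd'.fst'
  have hw : CodeFP (pairE σE natE) L (fun t => t.1.2.2) := (fst _ _).snd'.snd'
  have hj : CodeFP (pairE σE natE) unE (fun t => min t.2 t.1.2.1) := unOfNatMin.comp (hJ.pair (snd _ _))
  have hg : CodeFP (pairE σE natE) L (fun t => (t.1.2.2.drop (t.1.1 * min t.2 t.1.2.1)).take t.1.1) :=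
    (rawTakeNat natE).comp ((natOfUn.comp hI).pair ((rawDropUn natE).comp ((unMulC.comp (hI.pair hj)).pair hw)))
  refine (((map hg).comp ((CodeFP.id _).pair (urange.comp (snd _ _).fst'))).congr fun t => ?_)
  obtain ⟨I, J, w⟩ := t
  show (List.range J).map _ = chunksL I J w
  refine List.map_congr_left fun j hj => ?_
  dsimp only [id]
  rw [min_eq_left (List.mem_range.1 hj).le]

/-- **Sudan's interpolant on codes**: `(c, 1^I, 1^J, 1^q, Sl) ↦ interpL c I J q Sl`. [cite: AroraBarak2009, §1.3] -/
theorem interpLC : CodeFP sysE matE (fun t => interpL t.1 t.2.1 t.2.2.1 t.2.2.2.1 t.2.2.2.2) := by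
  have hker : CodeFP sysE (optE L) (fun t => kerVecK t.1 (t.2.2.1 * t.2.1) (rowsL t.1 t.2.1 t.2.2.1 t.2.2.2.1 t.2.2.2.2)) :=
    (kerVecKC.comp ((fst _ _).pair ((unMulC.comp ((snd _ _).snd'.fst'.pair (snd _ _).fst')).pair rowsLC)) :)
  have hcases := optCases (σ := (ℕ × ℕ × ℕ) × ℕ × ℕ × ℕ × List (List ℕ)) (eσ := sysE) (eα := L) (eδ := matE)
    (k := fun s o => match o with | none => [] | some w => chunksL s.2.1 s.2.2.1 w)
    (const _ ([] : List (List ℕ))) (chunksLC.comp ((fst _ _).snd'.fst'.pair ((fst _ _).snd'.snd'.fst'.pair (snd _ _))))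
    (fun _ => rfl) (fun _ _ => rfl)
  refine ((hcases.comp ((CodeFP.id _).pair hker)).congr fun t => ?_)
  simp only [interpL]
  cases kerVecK t.1 (t.2.2.1 * t.2.1) (rowsL t.1 t.2.1 t.2.2.1 t.2.2.2.1 t.2.2.2.2) <;> rfl

/-- **The agreement count on codes**: `(c, 1^q, Sl, f) ↦ agreeL c q Sl f`. [folklore] -/
theorem agreeLC : CodeFP (pairE kctxE (pairE unE (pairE matE L))) natE (fun t => agreeL t.1 t.2.1 t.2.2.1 t.2.2.2) := by
  let σE : (ℕ × ℕ × ℕ) × ℕ × List (List ℕ) × List ℕ → List Bool := pairE kctxE (pairE unE (pairE matE L))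
  have hp : CodeFP (pairE σE natE) bitE (fun t => decide (keval t.1.1 t.1.2.2.2 t.2 ∈ t.1.2.2.1.getD t.2 [])) :=
    (mem natE_injective).comp ((kevalC.comp ((fst _ _).fst'.pair ((fst _ _).snd'.snd'.snd'.pair (snd _ _)))).pair
      ((rawGetD L (d := ([] : List ℕ)) rfl).comp ((fst _ _).snd'.snd'.fst'.pair (snd _ _))))
  exact (((natLength natE).comp ((filter hp).comp ((CodeFP.id _).pair (urange.comp (snd _ _).fst')))).congr fun _ => rfl)

/-- **The candidates on codes**: `(c, 1^q, 1^cap, 1^D, Ql) ↦ candsL c q cap D Ql`. [folklore] -/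
theorem candsLC : CodeFP (pairE kctxE (pairE unE (pairE unE (pairE unE matE)))) matE
    (fun t => candsL t.1 t.2.1 t.2.2.1 t.2.2.2.1 t.2.2.2.2) := by
  have h := rrLevelsLC.comp ((fst _ _).pair ((urange.comp (snd _ _).fst').pair ((snd _ _).snd'.fst'.pair
    ((unSucc.comp (snd _ _).snd'.snd'.fst').pair (snd _ _).snd'.snd'.snd'))))
  exact (((map₀ (fst L matE)).comp h).congr fun _ => rfl)

/-- **The node test on codes**: `(c, nodes, known, f) ↦ nodesOK c nodes known f`. [folklore] -/
theorem nodesOKC : CodeFP (pairE kctxE (pairE L (pairE L L))) bitE (fun t => nodesOK t.1 t.2.1 t.2.2.1 t.2.2.2) := by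
  let σE : (ℕ × ℕ × ℕ) × List ℕ × List ℕ × List ℕ → List Bool := pairE kctxE (pairE L (pairE L L))
  have hp : CodeFP (pairE σE natE) bitE (fun t => keval t.1.1 t.1.2.2.2 (t.1.2.1.getD t.2 0) == t.1.2.2.1.getD t.2 0) :=
    (beq natE_injective).comp ((kevalC.comp ((fst _ _).fst'.pair ((fst _ _).snd'.snd'.snd'.pair ((rawGetD natE natE_zero).comp
      ((fst _ _).snd'.fst'.pair (snd _ _)))))).pair ((rawGetD natE natE_zero).comp ((fst _ _).snd'.snd'.fst'.pair (snd _ _))))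
  exact (((all hp).comp ((CodeFP.id _).pair (urange.comp ((ulength natE).comp (snd _ _).fst')))).congr fun _ => rfl)

/-- The code of the data of one decoding: `((c, 1^q, 1^I, 1^J), (1^D, A, 1^cap), (Sl, nodes, known))`. [folklore] -/
abbrev decE : ((ℕ × ℕ × ℕ) × ℕ × ℕ × ℕ) × (ℕ × ℕ × ℕ) × (List (List ℕ) × List ℕ × List ℕ) → List Bool :=
  pairE (pairE kctxE (pairE unE (pairE unE unE))) (pairE (pairE unE (pairE natE unE)) (pairE (rawE (rawE natE)) (pairE (rawE natE) (rawE natE))))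

/-- The decoding of one coordinate as a function of its data tuple. [folklore] -/
def decodeCoordT (t : ((ℕ × ℕ × ℕ) × ℕ × ℕ × ℕ) × (ℕ × ℕ × ℕ) × (List (List ℕ) × List ℕ × List ℕ)) : List ℕ :=
  decodeCoordL t.1.1 t.1.2.1 t.1.2.2.1 t.1.2.2.2 t.2.1.1 t.2.1.2.1 t.2.1.2.2 t.2.2.1 t.2.2.2.1 t.2.2.2.2

/-- **The survivors on codes.** [folklore] -/
theorem survLC : CodeFP decE matE
    (fun t => survL t.1.1 t.1.2.1 t.1.2.2.1 t.1.2.2.2 t.2.1.1 t.2.1.2.1 t.2.1.2.2 t.2.2.1 t.2.2.2.1 t.2.2.2.2) := by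
  have hc : CodeFP decE kctxE (fun t => t.1.1) := (fst _ _).fst'
  have hq : CodeFP decE unE (fun t => t.1.2.1) := (fst _ _).snd'.fst'
  have hI : CodeFP decE unE (fun t => t.1.2.2.1) := (fst _ _).snd'.snd'.fst'
  have hJ : CodeFP decE unE (fun t => t.1.2.2.2) := (fst _ _).snd'.snd'.snd'
  have hD : CodeFP decE unE (fun t => t.2.1.1) := (snd _ _).fst'.fst'
  have hA : CodeFP decE natE (fun t => t.2.1.2.1) := (snd _ _).fst'.snd'.fst'
  have hcap : CodeFP decE unE (fun t => t.2.1.2.2) := (snd _ _).fst'.snd'.snd'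
  have hSl : CodeFP decE matE (fun t => t.2.2.1) := (snd _ _).snd'.fst'
  have hnodes : CodeFP decE L (fun t => t.2.2.2.1) := (snd _ _).snd'.snd'.fst'
  have hknown : CodeFP decE L (fun t => t.2.2.2.2) := (snd _ _).snd'.snd'.snd'
  have hQ : CodeFP decE matE (fun t => interpL t.1.1 t.1.2.2.1 t.1.2.2.2 t.1.2.1 t.2.2.1) :=
    (interpLC.comp (hc.pair (hI.pair (hJ.pair (hq.pair hSl)))) :)
  have hcands : CodeFP decE matE (fun t => candsL t.1.1 t.1.2.1 t.2.1.2.2 t.2.1.1 (interpL t.1.1 t.1.2.2.1 t.1.2.2.2 t.1.2.1 t.2.2.1)) :=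
    (candsLC.comp (hc.pair (hq.pair (hcap.pair (hD.pair hQ)))) :)
  have hp : CodeFP (pairE decE L) bitE
      (fun t => decide (t.1.2.1.2.1 ≤ agreeL t.1.1.1 t.1.1.2.1 t.1.2.2.1 t.2) && nodesOK t.1.1.1 t.1.2.2.2.1 t.1.2.2.2.2 t.2) :=
    (natLe.comp ((hA.comp (fst _ _)).pair (agreeLC.comp ((hc.comp (fst _ _)).pair ((hq.comp (fst _ _)).pair ((hSl.comp (fst _ _)).pair
      (snd _ _))))))).and (nodesOKC.comp ((hc.comp (fst _ _)).pair ((hnodes.comp (fst _ _)).pair ((hknown.comp (fst _ _)).pair (snd _ _)))))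
  exact (((filter hp).comp ((CodeFP.id _).pair hcands)).congr fun _ => rfl)

/-- **Picking the unique survivor on codes.** [folklore] -/
theorem pickLC : CodeFP matE L pickL := by
  have hall : CodeFP (pairE L matE) bitE (fun t => t.2.all fun g => g == t.1) :=
    all ((beq (rawE_injective natE_injective)).comp ((snd _ _).pair (fst _ _)))
  have hcons : CodeFP (pairE unitE (pairE L matE)) L (fun t => if t.2.2.all (fun g => g == t.2.1) then t.2.1 else []) :=
    (hall.comp (snd _ _)).ite (snd _ _).fst' (const _ [])
  have h := rawCases (σ := Unit) (eσ := unitE) (eα := L) (eδ := L) (k := fun _ F => pickL F) (gnil := fun _ => [])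
    (gcons := fun t => if t.2.2.all (fun g => g == t.2.1) then t.2.1 else []) (const _ []) hcons (fun _ => rfl) (fun _ _ _ => rfl)
  exact (h.comp ((const _ ()).pair (CodeFP.id _))).congr fun _ => rfl

/-- **The decoding of one coordinate on codes.** [cite: Umans2003, §6.2; AroraBarak2009, §1.3] -/
theorem decodeCoordLC : CodeFP decE L decodeCoordT := (pickLC.comp survLC).congr fun _ => rfl

/-! ### The learning step on codes -/

variable {G : Type} {eG : G → List Bool} {gL : G → List (List ℕ) → List (List ℕ)}

/-- The code of the data of one learning step:
`(gd, ((c, 1^q, 1^I, 1^J), (1^D, A, 1^cap), 1^d), (Ws, nodes, knownLs))`. [folklore] -/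
abbrev lrnE (eG : G → List Bool) :
    G × ((((ℕ × ℕ × ℕ) × ℕ × ℕ × ℕ) × (ℕ × ℕ × ℕ) × ℕ) × (List (List (List ℕ)) × List ℕ × List (List ℕ))) → List Bool :=
  pairE eG (pairE (pairE (pairE kctxE (pairE unE (pairE unE unE))) (pairE (pairE unE (pairE natE unE)) unE))
    (pairE (rawE (rawE (rawE natE))) (pairE (rawE natE) (rawE (rawE natE)))))

/-- The type of the data of one learning step. [folklore] -/
abbrev LrnT (G : Type) : Type :=
  G × ((((ℕ × ℕ × ℕ) × ℕ × ℕ × ℕ) × (ℕ × ℕ × ℕ) × ℕ) × (List (List (List ℕ)) × List ℕ × List (List ℕ)))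

/-- The predicted lists at every position (first stage of `learnL`). [folklore] -/
def learnPredT (gL : G → List (List ℕ) → List (List ℕ)) (t : LrnT G) : List (List (List ℕ)) :=
  (List.range t.2.1.1.2.1).map fun b => gL t.1 (t.2.2.1.map fun T => T.getD b [])

/-- The coordinate polynomials (second stage of `learnL`). [folklore] -/
def learnFsT (gL : G → List (List ℕ) → List (List ℕ)) (t : LrnT G) : List (List ℕ) :=
  (List.range t.2.1.2.2).map fun j =>
    decodeCoordT ((t.2.1.1.1, t.2.1.1.2.1, t.2.1.1.2.2.1, t.2.1.1.2.2.2), t.2.1.2.1,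
      ((learnPredT gL t).map fun lst => lst.map fun u => u.getD j 0), t.2.2.2.1, t.2.2.2.2.map fun u => u.getD j 0)

/-- The learning step as a function of its data tuple. [folklore] -/
def learnT (gL : G → List (List ℕ) → List (List ℕ)) (t : LrnT G) : List (List ℕ) :=
  learnL t.2.1.1.1 t.2.1.1.2.1 t.2.1.1.2.2.1 t.2.1.1.2.2.2 t.2.1.2.1.1 t.2.1.2.1.2.1 t.2.1.2.1.2.2 t.2.1.2.2 (gL t.1) t.2.2.1 t.2.2.2.1 t.2.2.2.2

/-- `learnT` in stages. [folklore] -/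
theorem learnT_eq (gL : G → List (List ℕ) → List (List ℕ)) (t : LrnT G) :
    learnT gL t = (List.range t.2.1.1.2.1).map fun b => (learnFsT gL t).map fun f => keval t.2.1.1.1 f b := rfl

/-- Indexing the entries of a list of `L`-lists: `(lst, j) ↦ lst.map (·[j])`. [folklore] -/
theorem projC : CodeFP (pairE matE natE) L (fun t => t.1.map fun u => u.getD t.2 0) :=
  (map (σ := ℕ) (eσ := natE) (eα := L) (eβ := natE) (g := fun t => t.2.getD t.1 0) ((rawGetD natE natE_zero).comp
    ((snd _ _).pair (fst _ _)))).comp ((snd _ _).pair (fst _ _))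

/-- The predicted lists on codes. [folklore] -/
theorem learnPredTC (hg : CodeFP (pairE eG matE) matE (fun t => gL t.1 t.2)) : CodeFP (lrnE eG) (rawE matE) (learnPredT gL) := by
  have hgd : CodeFP (lrnE eG) eG (fun t => t.1) := fst _ _
  have hq : CodeFP (lrnE eG) unE (fun t => t.2.1.1.2.1) := (snd _ _).fst'.fst'.snd'.fst'
  have hWs : CodeFP (lrnE eG) (rawE matE) (fun t => t.2.2.1) := (snd _ _).snd'.fst'
  have hcol : CodeFP (pairE (lrnE eG) natE) matE (fun t => t.1.2.2.1.map fun T => T.getD t.2 []) :=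
    (map (σ := ℕ) (eσ := natE) (eα := matE) (eβ := L) (g := fun t => t.2.getD t.1 [])
      ((rawGetD L (d := ([] : List ℕ)) rfl).comp ((snd _ _).pair (fst _ _)))).comp ((snd _ _).pair (hWs.comp (fst _ _)))
  exact (((map (hg.comp ((hgd.comp (fst _ _)).pair hcol))).comp ((CodeFP.id _).pair (urange.comp hq))).congr fun _ => rfl)

/-- The coordinate polynomials on codes. [folklore] -/
theorem learnFsTC (hg : CodeFP (pairE eG matE) matE (fun t => gL t.1 t.2)) : CodeFP (lrnE eG) matE (learnFsT gL) := by
  have hc : CodeFP (lrnE eG) kctxE (fun t => t.2.1.1.1) := (snd _ _).fst'.fst'.fst'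
  have hq : CodeFP (lrnE eG) unE (fun t => t.2.1.1.2.1) := (snd _ _).fst'.fst'.snd'.fst'
  have hI : CodeFP (lrnE eG) unE (fun t => t.2.1.1.2.2.1) := (snd _ _).fst'.fst'.snd'.snd'.fst'
  have hJ : CodeFP (lrnE eG) unE (fun t => t.2.1.1.2.2.2) := (snd _ _).fst'.fst'.snd'.snd'.snd'
  have hDAc : CodeFP (lrnE eG) (pairE unE (pairE natE unE)) (fun t => t.2.1.2.1) := (snd _ _).fst'.snd'.fst'
  have hd : CodeFP (lrnE eG) unE (fun t => t.2.1.2.2) := (snd _ _).fst'.snd'.snd'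
  have hnodes : CodeFP (lrnE eG) L (fun t => t.2.2.2.1) := (snd _ _).snd'.snd'.fst'
  have hknown : CodeFP (lrnE eG) matE (fun t => t.2.2.2.2) := (snd _ _).snd'.snd'.snd'
  -- item `j`, context `(t, predTab)`
  let ctxE := pairE (lrnE eG) (rawE matE)
  have hSlj : CodeFP (pairE ctxE natE) matE (fun t => t.1.2.map fun lst => lst.map fun u => u.getD t.2 0) :=
    (map (σ := ℕ) (eσ := natE) (eα := matE) (eβ := L) (g := fun t => t.2.map fun u => u.getD t.1 0) (projC.comp ((snd _ _).pair
      (fst _ _)))).comp ((snd _ _).pair (fst _ _).snd')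
  have hknj : CodeFP (pairE ctxE natE) L (fun t => t.1.1.2.2.2.2.map fun u => u.getD t.2 0) :=
    projC.comp ((hknown.comp (fst _ _).fst').pair (snd _ _))
  have htuple : CodeFP (pairE ctxE natE) decE (fun t => ((t.1.1.2.1.1.1, t.1.1.2.1.1.2.1, t.1.1.2.1.1.2.2.1, t.1.1.2.1.1.2.2.2),
      t.1.1.2.1.2.1, (t.1.2.map fun lst => lst.map fun u => u.getD t.2 0), t.1.1.2.2.2.1, t.1.1.2.2.2.2.map fun u => u.getD t.2 0)) :=
    ((hc.pair (hq.pair (hI.pair hJ))).comp (fst _ _).fst').pair ((hDAc.comp (fst _ _).fst').pair (hSlj.pair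
      ((hnodes.comp (fst _ _).fst').pair hknj)))
  have hfj := decodeCoordLC.comp htuple
  exact (((map hfj).comp (((CodeFP.id _).pair (learnPredTC hg)).pair (urange.comp hd))).congr fun _ => rfl)

/-- A table row: the values of the polynomials `fs` at `b`. [folklore] -/
theorem tabRowC : CodeFP (pairE (pairE kctxE matE) natE) L (fun t => t.1.2.map fun f => keval t.1.1 f t.2) := by
  have hk := kevalC.comp ((fst (pairE kctxE natE) L).fst'.pair ((snd (pairE kctxE natE) L).pair (fst (pairE kctxE natE) L).snd'))
  exact (((map hk).comp (((fst _ _).fst'.pair (snd _ _)).pair (fst (pairE kctxE matE) natE).snd')).congr fun _ => rfl)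

/-- The table of the values of `fs` at all `b < q`. [folklore] -/
theorem tabC : CodeFP (pairE kctxE (pairE matE unE)) matE (fun t => (List.range t.2.2).map fun b => t.2.1.map fun f => keval t.1 f b) :=
  ((map tabRowC).comp (((fst _ _).pair (snd _ _).fst').pair (urange.comp (snd kctxE (pairE matE unE)).snd'))).congr fun _ => rfl

/-- **The learning step on codes**, the predictor program given by its own `CodeFP` certificate.
[cite: Umans2003, Lemma 17, §6.2; AroraBarak2009, §1.3] -/
theorem learnLC (hg : CodeFP (pairE eG matE) matE (fun t => gL t.1 t.2)) : CodeFP (lrnE eG) matE (learnT gL) := by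
  have hc : CodeFP (lrnE eG) kctxE (fun t => t.2.1.1.1) := (snd _ _).fst'.fst'.fst'
  have hq : CodeFP (lrnE eG) unE (fun t => t.2.1.1.2.1) := (snd _ _).fst'.fst'.snd'.fst'
  have htab : CodeFP (lrnE eG) matE (fun t => (List.range t.2.1.1.2.1).map fun b => (learnFsT gL t).map fun f => keval t.2.1.1.1 f b) :=
    (tabC.comp (hc.pair ((learnFsTC hg).pair hq)) :)
  exact htab.congr fun t => (learnT_eq gL t).symm

/-- The interleaved step as a function of its data tuple
`(gd, (params, 1^{n₀}), (bnodes₁, bnodes₀), (Ws₁, Ws₂))`. [folklore] -/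
def stepT (gL : G → List (List ℕ) → List (List ℕ))
    (t : G × (((((ℕ × ℕ × ℕ) × ℕ × ℕ × ℕ) × (ℕ × ℕ × ℕ) × ℕ) × ℕ) × (List ℕ × List ℕ) × (List (List (List ℕ)) × List (List (List ℕ))))) :
    List (List ℕ) × List (List ℕ) :=
  stepL t.2.1.1.1.1 t.2.1.1.1.2.1 t.2.1.1.1.2.2.1 t.2.1.1.1.2.2.2 t.2.1.1.2.1.1 t.2.1.1.2.1.2.1 t.2.1.1.2.1.2.2 t.2.1.1.2.2 t.2.1.2
    (gL t.1) t.2.2.1.1 t.2.2.1.2 t.2.2.2.1 t.2.2.2.2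

/-- The code of the data of one interleaved step. [folklore] -/
abbrev stpE (eG : G → List Bool) :
    G × (((((ℕ × ℕ × ℕ) × ℕ × ℕ × ℕ) × (ℕ × ℕ × ℕ) × ℕ) × ℕ) × (List ℕ × List ℕ) × (List (List (List ℕ)) × List (List (List ℕ)))) → List Bool :=
  pairE eG (pairE (pairE (pairE (pairE kctxE (pairE unE (pairE unE unE))) (pairE (pairE unE (pairE natE unE)) unE)) unE)
    (pairE (pairE (rawE natE) (rawE natE)) (pairE (rawE (rawE (rawE natE))) (rawE (rawE (rawE natE))))))

/-- **The interleaved step on codes.** [cite: Umans2003, Lemma 17; AroraBarak2009, §1.3] -/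
theorem stepLC (hg : CodeFP (pairE eG matE) matE (fun t => gL t.1 t.2)) : CodeFP (stpE eG) (pairE matE matE) (stepT gL) := by
  have hgd : CodeFP (stpE eG) eG (fun t => t.1) := fst _ _
  have hpar : CodeFP (stpE eG) (pairE (pairE kctxE (pairE unE (pairE unE unE))) (pairE (pairE unE (pairE natE unE)) unE))
      (fun t => t.2.1.1) := (snd _ _).fst'.fst'
  have hn0 : CodeFP (stpE eG) unE (fun t => t.2.1.2) := (snd _ _).fst'.snd'
  have hb1 : CodeFP (stpE eG) L (fun t => t.2.2.1.1) := (snd _ _).snd'.fst'.fst'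
  have hb0 : CodeFP (stpE eG) L (fun t => t.2.2.1.2) := (snd _ _).snd'.fst'.snd'
  have hW1 : CodeFP (stpE eG) (rawE matE) (fun t => t.2.2.2.1) := (snd _ _).snd'.snd'.fst'
  have hW2 : CodeFP (stpE eG) (rawE matE) (fun t => t.2.2.2.2) := (snd _ _).snd'.snd'.snd'
  -- indexing a table by a list of positions: `(T, xs) ↦ xs.map (T.getD · [])`
  have hidx : CodeFP (pairE matE L) matE (fun t => t.2.map fun x => t.1.getD x []) :=
    map (σ := List (List ℕ)) (eσ := matE) (eα := natE) (eβ := L) (g := fun t => t.1.getD t.2 []) (rawGetD L (d := ([] : List ℕ)) rfl)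
  -- the last table of `C₂`'s window: index `n₀ - 1`
  have hlast : CodeFP (stpE eG) matE (fun t => t.2.2.2.2.getD (t.2.1.2 - 1) []) :=
    (rawGetD matE (d := ([] : List (List ℕ))) rfl).comp (hW2.pair (natSub.comp ((natOfUn.comp hn0).pair (const _ 1))))
  have hk1 : CodeFP (stpE eG) matE (fun t => t.2.2.1.1.map fun x => (t.2.2.2.2.getD (t.2.1.2 - 1) []).getD x []) :=
    (hidx.comp (hlast.pair hb1) :)
  have hU1 : CodeFP (stpE eG) matE (fun t => learnT gL (t.1, t.2.1.1, t.2.2.2.1, t.2.2.1.1,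
      t.2.2.1.1.map fun x => (t.2.2.2.2.getD (t.2.1.2 - 1) []).getD x [])) :=
    ((learnLC hg).comp (hgd.pair (hpar.pair (hW1.pair (hb1.pair hk1)))) :)
  have hk0 : CodeFP (stpE eG) matE (fun t => t.2.2.1.2.map fun x => (learnT gL (t.1, t.2.1.1, t.2.2.2.1, t.2.2.1.1,
      t.2.2.1.1.map fun x => (t.2.2.2.2.getD (t.2.1.2 - 1) []).getD x [])).getD x []) :=
    (hidx.comp (hU1.pair hb0) :)
  have hU2 : CodeFP (stpE eG) matE (fun t => learnT gL (t.1, t.2.1.1, t.2.2.2.2, t.2.2.1.2,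
      t.2.2.1.2.map fun x => (learnT gL (t.1, t.2.1.1, t.2.2.2.1, t.2.2.1.1,
        t.2.2.1.1.map fun x => (t.2.2.2.2.getD (t.2.1.2 - 1) []).getD x [])).getD x [])) :=
    ((learnLC hg).comp (hgd.pair (hpar.pair (hW2.pair (hb0.pair hk0)))) :)
  exact ((hU1.pair hU2).congr fun _ => rfl)

end Machine

end UmansFP

end Literature.Computability.Complexity

end
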